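import Summits.HodgeConjecture.HodgeConjecture.Theorems.F0P6aStubFROBQuotWD
import HarnessLib
import HarnessLib.Audit.LibrarySuggestionsDenyListCruxes

/-! Import notes («M-142a» (A): canonical bare header; the per-import commentary lives here):
* `Summits.HodgeConjecture.HodgeConjecture.Theorems.F0P6aStubFROBQuotWD` — ★ twin (LAST part) of tree `Lines/F0_P6a_StubFROBQuotWD.lean` d650a8dd3d22567b (370 l.) -/

/-! # F0_P6a_StubFROBQuotWD — NEXT EDITION = SHIM (★ re-home, IMPORT-ONLY; K6 L3 column, dealer LA3-plan (g5) PLAN v2).  The 4 declaration commands of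
this workfile (namespace ``Summit.HodgeConjecture.HodgeConjecture.Cruxes.HLiu418.F0P6aStubFROBQuotWD`` KEPT ⇒ identical fully-qualified names) now
live in ★ `Theorems/F0P6aStubFROBQuotWD.lean` (tree :1–:370) — the tree bytes of d650a8dd3d22567b re-homed whole, with its `Lines/` imports switched
to their ★ re-homes, 0 statement ∕ proof bytes changed.  This file only imports the last part (transitively all), so the module
`…Cruxes.HLiu418.Lines.F0_P6a_StubFROBQuotWD` keeps serving every name to its importers (Lines-tree importers: `F0_P6a_StubFROB` — each switches to
the ★ module in its own twin ∕ shim).  It declares nothing.  Edition history stays in git; future changes are ★-side proposals on the `Theorems/`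
parts.  HC_CM is proved only modulo the 7 printed citations (2 remaining named inputs hLiu418 = stmt-HodgeConjecture-24832, h413 =
stmt-HodgeConjecture-24833) until rung 0 closes; count-neutral (0 `sorry`, 0 socket, 0 declaration). -/
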